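import Literature.AlgebraicGeometry.Motives.AbelianVarietyDegreePullback
import HarnessLib

/-!
# Transfer of the `h⁰`-asymptotic degree along finite flat covers:
# `h⁰(n f^*D) = r δ nᵉ/e! + O(nᵉ⁻¹)` from `h⁰(nD) = δ nᵉ/e! + O(nᵉ⁻¹)`, unconditionally

`Motives/AbelianVarietyDegreePullback` deduces the named fact
`CartierDivisor.asympDegree_pullback_eq` (Görtz–Wedhorn II, Prop. 23.84 for the `h⁰`-asymptotic
degrees) from asymptotic Riemann–Roch for ample divisors (Prop. 23.83,
`asymptoticRiemannRoch_of_isAmple`) by comparing the two expansions that Prop. 23.83 provides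
upstairs and downstairs. This file sharpens that: the expansion **upstairs follows from the one
downstairs**, with no appeal to Prop. 23.83 at all.

* `CartierDivisor.HasAsympDegree.pullback_of_isAmple`: for `f : X → Y` finite flat surjective of
  constant rank `r` between integral `K`-schemes and `D` ample on `Y`,
  `h⁰(nD) = δ nᵉ/e! + O(nᵉ⁻¹)` with `δ > 0` implies `h⁰(n f^*D) = rδ nᵉ/e! + O(nᵉ⁻¹)` — from the
  sandwich `r h⁰(mD) ≤ h⁰((m+a) f^*D)`, `h⁰(m f^*D) ≤ r h⁰((m+a)D)` (`Motives/FiniteFlatSandwich`;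
  the finite-dimensionality it needs upstairs is itself transferred from downstairs through the
  injection `Γ(m f^*D) ↪ Γ((m+a)D)^r`, `exists_finiteDimensional_pullback_of_finiteDimensional`)
  and the elementary estimate `(n+a)ᵉ - nᵉ = O(nᵉ⁻¹)` (`isBigO_of_sandwich`);
* `CartierDivisor.asympDegree_pullback_eq_of_hasAsympDegree`: hence
  `asympDegree(f^*D, dim X) = r · asympDegree(D, dim Y)` **whenever `D` has a positive
  `h⁰`-asymptotic degree in dimension `dim Y`** — i.e. Prop. 23.84 in the form of the named fact
  holds for `(f, D)` as soon as the existence clause of Prop. 23.83 holds for `D` alone; this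
  supersedes `CartierDivisor.hasAsympDegree_pullback_of_facts` (`Motives/AbelianVarietyDegree`),
  which assumed both Prop. 23.83 and Prop. 23.84.

* `CartierDivisor.asympDegree_pullback_eq_of_exists_hasAsympDegree`,
  `CartierDivisor.asympDegree_pullback_eq_of_forall_not_hasAsympDegree`: the junk cases — the
  named fact holds for `(f, D)` whenever `D` has *some* `ℕ`-valued asymptotic degree (also `0`,
  `HasAsympDegree.pullback_zero_of_isAmple`), or `f^*D` has no positive one.

What is *not* provable here (and why the named fact stays conditional on Prop. 23.83): exactly the
configuration "`D` has no `ℕ`-valued asymptotic degree while `f^*D` has one, `δ' > 0`" (then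
`r ∤ δ'`): the sandwich only shows `h⁰(nD) = (δ'/r) nᵉ/e! + O(nᵉ⁻¹)`; excluding it requires the
integrality (`= (𝒪(D)ᵉ)`) of the leading coefficient, i.e. intersection theory / Prop. 23.83.

Mathlib searched and used: `geom_sum₂_mul`, `Finset.sum_le_card_nsmul`, `Asymptotics.isBigO_iff`,
`Asymptotics.IsBigO.comp_tendsto`, `Filter.tendsto_sub_atTop_nat`, `Filter.Tendsto.zpow₀`,
`Module.Finite.of_injective`.

## References

* U. Görtz, T. Wedhorn, *Algebraic Geometry II: Cohomology of Schemes*, Springer Spektrum (2023),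
  doi:10.1007/978-3-658-43031-3: Prop. 23.83, Prop. 23.84 (p. 447). [GortzWedhorn2023]
-/

universe u

open CategoryTheory AlgebraicGeometry Asymptotics Filter Topology Finset

noncomputable section

namespace Literature.AlgebraicGeometry.Motives

/-! ### Elementary estimates: `(x+a)ᵉ - xᵉ`, shifts in `O(nᶻ)` -/

section Estimates

/-- `(x + a)ᵉ - xᵉ ≤ e · a · (x + a)ᵉ⁻¹` for `x, a ≥ 0` (from
`(x+a)ᵉ - xᵉ = a ∑_{i<e} (x+a)ⁱ xᵉ⁻¹⁻ⁱ`). [folklore] -/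
theorem add_pow_sub_pow_le {x a : ℝ} (hx : 0 ≤ x) (ha : 0 ≤ a) (e : ℕ) :
    (x + a) ^ e - x ^ e ≤ e * a * (x + a) ^ (e - 1) := by
  have hxa : x ≤ x + a := le_add_of_nonneg_right ha
  have h := geom_sum₂_mul (x + a) x e
  rw [add_sub_cancel_left] at h
  rw [← h]
  have hsum : ∑ i ∈ range e, (x + a) ^ i * x ^ (e - 1 - i) ≤ e * (x + a) ^ (e - 1) := by
    have hle : ∀ i ∈ range e, (x + a) ^ i * x ^ (e - 1 - i) ≤ (x + a) ^ (e - 1) := by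
      intro i hi
      have hi' : i < e := mem_range.1 hi
      calc (x + a) ^ i * x ^ (e - 1 - i) ≤ (x + a) ^ i * (x + a) ^ (e - 1 - i) :=
            mul_le_mul_of_nonneg_left (pow_le_pow_left₀ hx hxa _) (pow_nonneg (hx.trans hxa) _)
        _ = (x + a) ^ (e - 1) := by rw [← pow_add]; congr 1; omega
    have h2 := Finset.sum_le_card_nsmul (range e) _ _ hle
    rwa [card_range, nsmul_eq_mul] at h2
  calc (∑ i ∈ range e, (x + a) ^ i * x ^ (e - 1 - i)) * a ≤ e * (x + a) ^ (e - 1) * a :=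
        mul_le_mul_of_nonneg_right hsum ha
    _ = e * a * (x + a) ^ (e - 1) := by ring

/-- `(n + a)ᵉ - nᵉ = O(nᵉ⁻¹)` as `n → ∞` (`ℕ`-exponent `e`, compared with `n^{(e:ℤ)-1}`).
[folklore] -/
theorem isBigO_add_pow_sub_pow (a e : ℕ) :
    (fun n : ℕ => ((n : ℝ) + a) ^ e - (n : ℝ) ^ e) =O[atTop] fun n : ℕ => (n : ℝ) ^ ((e : ℤ) - 1) := by
  cases e with
  | zero => simp only [pow_zero, sub_self]; exact isBigO_zero _ _
  | succ k =>
    refine isBigO_iff.2 ⟨(k + 1 : ℕ) * a * 2 ^ k, ?_⟩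
    filter_upwards [eventually_ge_atTop (max a 1)] with n hn
    have hna : (a : ℝ) ≤ n := by exact_mod_cast le_of_max_le_left hn
    have hn0 : (0 : ℝ) ≤ n := Nat.cast_nonneg n
    have ha0 : (0 : ℝ) ≤ a := Nat.cast_nonneg a
    have hz : ((k + 1 : ℕ) : ℤ) - 1 = (k : ℕ) := by push_cast; ring
    rw [hz, zpow_natCast, Real.norm_eq_abs, Real.norm_eq_abs, abs_of_nonneg (pow_nonneg hn0 k),
      abs_of_nonneg (sub_nonneg.2 (pow_le_pow_left₀ hn0 (le_add_of_nonneg_right ha0) _))]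
    calc ((n : ℝ) + a) ^ (k + 1) - (n : ℝ) ^ (k + 1)
        ≤ (k + 1 : ℕ) * a * ((n : ℝ) + a) ^ (k + 1 - 1) := add_pow_sub_pow_le hn0 ha0 (k + 1)
      _ = (k + 1 : ℕ) * a * ((n : ℝ) + a) ^ k := by rw [Nat.add_sub_cancel]
      _ ≤ (k + 1 : ℕ) * a * (2 * n) ^ k := by
          refine mul_le_mul_of_nonneg_left (pow_le_pow_left₀ (by positivity) (by linarith) k) ?_
          positivity
      _ = (k + 1 : ℕ) * a * 2 ^ k * (n : ℝ) ^ k := by rw [mul_pow]; ring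

/-- `(n + a)ᶻ = O(nᶻ)` for every integer `z` (the ratio tends to `1`). [folklore] -/
theorem isBigO_cast_add_zpow (a : ℕ) (z : ℤ) :
    (fun n : ℕ => ((n : ℝ) + a) ^ z) =O[atTop] fun n : ℕ => (n : ℝ) ^ z := by
  have h1 : Tendsto (fun n : ℕ => ((n : ℝ) + a) / n) atTop (𝓝 1) := by
    have h : Tendsto (fun n : ℕ => (1 : ℝ) + (a : ℝ) / n) atTop (𝓝 (1 + 0)) :=
      tendsto_const_nhds.add (tendsto_const_div_atTop_nhds_zero_nat (a : ℝ))
    rw [add_zero] at h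
    refine h.congr' ?_
    filter_upwards [eventually_ge_atTop 1] with n hn
    have hn0 : (n : ℝ) ≠ 0 := Nat.cast_ne_zero.2 (by omega)
    rw [add_div, div_self hn0]
  have h2 := h1.zpow₀ z (Or.inl one_ne_zero)
  rw [one_zpow] at h2
  have h3 : ∀ᶠ n : ℕ in atTop, (((n : ℝ) + a) / n) ^ z ≤ 2 := h2.eventually (eventually_le_nhds one_lt_two)
  refine isBigO_iff.2 ⟨2, ?_⟩
  filter_upwards [h3, eventually_ge_atTop 1] with n hn hn1
  have hn0 : (0 : ℝ) < n := Nat.cast_pos.2 (by omega)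
  have hnz : (0 : ℝ) < (n : ℝ) ^ z := zpow_pos hn0 z
  rw [Real.norm_eq_abs, Real.norm_eq_abs, abs_of_pos (zpow_pos (by positivity) z), abs_of_pos hnz]
  rw [div_zpow, div_le_iff₀ hnz] at hn
  exact hn

/-- `(n - a)ᶻ = O(nᶻ)` (`ℕ`-subtraction) for every integer `z`. [folklore] -/
theorem isBigO_cast_sub_zpow (a : ℕ) (z : ℤ) :
    (fun n : ℕ => ((n - a : ℕ) : ℝ) ^ z) =O[atTop] fun n : ℕ => (n : ℝ) ^ z := by
  have h1 : Tendsto (fun n : ℕ => ((n - a : ℕ) : ℝ) / n) atTop (𝓝 1) := by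
    have h : Tendsto (fun n : ℕ => (1 : ℝ) - (a : ℝ) / n) atTop (𝓝 (1 - 0)) :=
      tendsto_const_nhds.sub (tendsto_const_div_atTop_nhds_zero_nat (a : ℝ))
    rw [sub_zero] at h
    refine h.congr' ?_
    filter_upwards [eventually_ge_atTop (max a 1)] with n hn
    have hn0 : (n : ℝ) ≠ 0 := Nat.cast_ne_zero.2 (by omega)
    rw [Nat.cast_sub (le_of_max_le_left hn), sub_div, div_self hn0]
  have h2 := h1.zpow₀ z (Or.inl one_ne_zero)
  rw [one_zpow] at h2
  have h3 : ∀ᶠ n : ℕ in atTop, (((n - a : ℕ) : ℝ) / n) ^ z ≤ 2 :=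
    h2.eventually (eventually_le_nhds one_lt_two)
  refine isBigO_iff.2 ⟨2, ?_⟩
  filter_upwards [h3, eventually_gt_atTop a] with n hn hn1
  have hn0 : (0 : ℝ) < n := Nat.cast_pos.2 (by omega)
  have hna : (0 : ℝ) < ((n - a : ℕ) : ℝ) := Nat.cast_pos.2 (by omega)
  have hnz : (0 : ℝ) < (n : ℝ) ^ z := zpow_pos hn0 z
  rw [Real.norm_eq_abs, Real.norm_eq_abs, abs_of_pos (zpow_pos hna z), abs_of_pos hnz]
  rw [div_zpow, div_le_iff₀ hnz] at hn
  exact hn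

/-- Forward shifts preserve `O(nᶻ)`: `F(n + a) = O(nᶻ)` if `F(n) = O(nᶻ)`. [folklore] -/
theorem IsBigO.shift {F : ℕ → ℝ} {z : ℤ} (h : F =O[atTop] fun n : ℕ => (n : ℝ) ^ z) (a : ℕ) :
    (fun n : ℕ => F (n + a)) =O[atTop] fun n : ℕ => (n : ℝ) ^ z := by
  have h1 := h.comp_tendsto (tendsto_add_atTop_nat a)
  refine h1.trans ?_
  refine (isBigO_cast_add_zpow a z).congr_left fun n => ?_
  simp only [Function.comp, Nat.cast_add]

/-- Backward shifts: `F = O(nᶻ)` if `F(m + a) = O(mᶻ)` as a function of `m`. [folklore] -/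
theorem IsBigO.of_shift {F : ℕ → ℝ} {z : ℤ} (a : ℕ)
    (h : (fun m : ℕ => F (m + a)) =O[atTop] fun m : ℕ => (m : ℝ) ^ z) :
    F =O[atTop] fun n : ℕ => (n : ℝ) ^ z := by
  have h1 := h.comp_tendsto (tendsto_sub_atTop_nat a)
  have h2 : (fun n : ℕ => F (n - a + a)) =ᶠ[atTop] F := by
    filter_upwards [eventually_ge_atTop a] with n hn
    rw [Nat.sub_add_cancel hn]
  exact (h1.congr' h2 EventuallyEq.rfl).trans (isBigO_cast_sub_zpow a z)

/-- **Transfer of asymptotics through a sandwich.** If `u(n) = δ nᵉ/e! + O(nᵉ⁻¹)` and, for all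
large `m`, `r u(m) ≤ v(m + a)` and `v(m) ≤ r u(m + a)`, then `v(n) = rδ nᵉ/e! + O(nᵉ⁻¹)`.
[folklore] -/
theorem isBigO_of_sandwich {u v : ℕ → ℝ} {δ r : ℝ} {e a : ℕ}
    (hu : (fun n : ℕ => u n - δ * (n : ℝ) ^ e / e.factorial) =O[atTop]
      fun n : ℕ => (n : ℝ) ^ ((e : ℤ) - 1))
    (hr : 0 ≤ r) (h1 : ∀ᶠ m : ℕ in atTop, r * u m ≤ v (m + a))
    (h2 : ∀ᶠ m : ℕ in atTop, v m ≤ r * u (m + a)) :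
    (fun n : ℕ => v n - r * δ * (n : ℝ) ^ e / e.factorial) =O[atTop]
      fun n : ℕ => (n : ℝ) ^ ((e : ℤ) - 1) := by
  -- the error term `E n = u n - δ nᵉ/e!` and the constant `c = rδ/e!`
  obtain ⟨E, hE⟩ : ∃ E : ℕ → ℝ, ∀ n, E n = u n - δ * (n : ℝ) ^ e / e.factorial :=
    ⟨_, fun n => rfl⟩
  obtain ⟨c, hc⟩ : ∃ c : ℝ, c = r * δ / e.factorial := ⟨_, rfl⟩
  have hEO : E =O[atTop] fun n : ℕ => (n : ℝ) ^ ((e : ℤ) - 1) :=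
    hu.congr_left fun n => (hE n).symm
  have hE2 : (fun m : ℕ => E (m + 2 * a)) =O[atTop] fun n : ℕ => (n : ℝ) ^ ((e : ℤ) - 1) :=
    IsBigO.shift hEO (2 * a)
  have hP1 : (fun m : ℕ => ((m : ℝ) + a) ^ e - (m : ℝ) ^ e) =O[atTop]
      fun n : ℕ => (n : ℝ) ^ ((e : ℤ) - 1) := isBigO_add_pow_sub_pow a e
  have hP2 : (fun m : ℕ => ((m : ℝ) + (2 * a : ℕ)) ^ e - (m : ℝ) ^ e) =O[atTop]
      fun n : ℕ => (n : ℝ) ^ ((e : ℤ) - 1) := isBigO_add_pow_sub_pow (2 * a) e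
  -- the dominating function
  obtain ⟨H, hH⟩ : ∃ H : ℕ → ℝ, ∀ m, H m = |c| * ((((m : ℝ) + a) ^ e - (m : ℝ) ^ e) +
      (((m : ℝ) + (2 * a : ℕ)) ^ e - (m : ℝ) ^ e)) + r * (|E m| + |E (m + 2 * a)|) :=
    ⟨_, fun m => rfl⟩
  have hHO : H =O[atTop] fun n : ℕ => (n : ℝ) ^ ((e : ℤ) - 1) := by
    have h := IsBigO.add ((hP1.add hP2).const_mul_left |c|)
      ((hEO.abs_left.add hE2.abs_left).const_mul_left r)
    exact h.congr_left fun m => (hH m).symm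
  -- `|v (m+a) - c (m+a)^e| ≤ H m` for large `m`
  have h2' : ∀ᶠ m : ℕ in atTop, v (m + a) ≤ r * u (m + a + a) :=
    (tendsto_add_atTop_nat a).eventually h2
  have hG : ∀ᶠ m : ℕ in atTop,
      ‖v (m + a) - r * δ * (((m + a : ℕ) : ℝ)) ^ e / e.factorial‖ ≤ 1 * ‖H m‖ := by
    filter_upwards [h1, h2'] with m hm1 hm2
    -- atoms
    obtain ⟨A, hA⟩ : ∃ A : ℝ, A = ((m : ℝ) + a) ^ e := ⟨_, rfl⟩
    obtain ⟨A2, hA2⟩ : ∃ A2 : ℝ, A2 = ((m : ℝ) + (2 * a : ℕ)) ^ e := ⟨_, rfl⟩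
    obtain ⟨B, hB⟩ : ∃ B : ℝ, B = (m : ℝ) ^ e := ⟨_, rfl⟩
    have hm0 : (0 : ℝ) ≤ m := Nat.cast_nonneg m
    have ha0 : (0 : ℝ) ≤ a := Nat.cast_nonneg a
    have hBA : B ≤ A := by
      rw [hA, hB]; exact pow_le_pow_left₀ hm0 (le_add_of_nonneg_right ha0) _
    have hAA2 : A ≤ A2 := by
      rw [hA, hA2]; refine pow_le_pow_left₀ (by positivity) ?_ _; push_cast; linarith
    -- the two sandwich inequalities in terms of the atoms
    have hm1' : c * B + r * E m ≤ v (m + a) := by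
      have e1 : r * u m = c * B + r * E m := by rw [hE, hc, hB]; ring
      linarith
    have hm2' : v (m + a) ≤ c * A2 + r * E (m + 2 * a) := by
      have e2 : r * u (m + a + a) = c * A2 + r * E (m + 2 * a) := by
        rw [show m + a + a = m + 2 * a by ring, hE, hc, hA2]; push_cast; ring
      linarith
    have hgoal : r * δ * (((m + a : ℕ) : ℝ)) ^ e / e.factorial = c * A := by
      rw [hc, hA]; push_cast; ring
    have hHm : H m = |c| * ((A - B) + (A2 - B)) + r * (|E m| + |E (m + 2 * a)|) := by
      rw [hH, hA, hA2, hB]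
    -- elementary bounds
    have t1 : c * (A - B) ≤ |c| * (A - B) :=
      mul_le_mul_of_nonneg_right (le_abs_self c) (sub_nonneg.2 hBA)
    have t2 : c * (A2 - A) ≤ |c| * (A2 - B) := by
      have s1 : c * (A2 - A) ≤ |c| * (A2 - A) :=
        mul_le_mul_of_nonneg_right (le_abs_self c) (sub_nonneg.2 hAA2)
      have s2 : |c| * (A2 - A) ≤ |c| * (A2 - B) :=
        mul_le_mul_of_nonneg_left (by linarith) (abs_nonneg c)
      linarith
    have t3 : -(r * |E m|) ≤ r * E m := by
      have := mul_le_mul_of_nonneg_left (neg_abs_le (E m)) hr; linarith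
    have t4 : r * E (m + 2 * a) ≤ r * |E (m + 2 * a)| :=
      mul_le_mul_of_nonneg_left (le_abs_self _) hr
    have t5 : 0 ≤ |c| * (A2 - B) := mul_nonneg (abs_nonneg c) (by linarith)
    have t6 : 0 ≤ |c| * (A - B) := mul_nonneg (abs_nonneg c) (sub_nonneg.2 hBA)
    have t7 : 0 ≤ r * |E m| := mul_nonneg hr (abs_nonneg _)
    have t8 : 0 ≤ r * |E (m + 2 * a)| := mul_nonneg hr (abs_nonneg _)
    have hHm0 : 0 ≤ H m := by rw [hHm]; nlinarith
    rw [hgoal, one_mul, Real.norm_eq_abs, Real.norm_eq_abs, abs_of_nonneg hHm0, abs_le, hHm]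
    have d1 : c * (A - B) = c * A - c * B := by ring
    have d2 : c * (A2 - A) = c * A2 - c * A := by ring
    have d3 : |c| * ((A - B) + (A2 - B)) = |c| * (A - B) + |c| * (A2 - B) := by ring
    constructor
    · linarith
    · linarith
  have hGO : (fun m : ℕ => v (m + a) - r * δ * (((m + a : ℕ) : ℝ)) ^ e / e.factorial) =O[atTop]
      fun n : ℕ => (n : ℝ) ^ ((e : ℤ) - 1) := (IsBigO.of_bound 1 hG).trans hHO
  exact IsBigO.of_shift a hGO

end Estimates

/-! ### Transfer of the asymptotic degree along a finite flat cover -/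

namespace CartierDivisor

open FunctionFieldOver

variable (K : Type u) [Field K] {X Y : Scheme.{u}} [IsIntegral X] [IsIntegral Y]
  [X.Over (Spec (.of K))] [Y.Over (Spec (.of K))] (f : X ⟶ Y) [IsDominant f]
  [f.IsOver (Spec (.of K))] [IsFinite f] (D : CartierDivisor Y)

/-- **Finite-dimensionality transfers upstairs**: for `D` ample on `Y` (quasi-compact) there is
`a'` such that `Γ(X, 𝒪(m f^*D))` is finite-dimensional whenever `Γ(Y, 𝒪((m+a')D))` is — by
the injection `Γ(m f^*D) ↪ Γ((m+a')D)^r` of `Motives/FiniteFlatSandwich`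
(`eventually_exists_linearMap_sections_pi`). [folklore] -/
theorem exists_finiteDimensional_pullback_of_finiteDimensional (hD : D.IsAmple) :
    ∃ a' : ℕ, ∀ m : ℕ, FiniteDimensional K (((m + a') • D).sections K) →
      FiniteDimensional K ((m • D.pullback f).sections K) := by
  obtain ⟨hc, -, d, -, H⟩ := hD
  obtain ⟨s, hs, hη, haff⟩ := H (genericPoint Y)
  obtain ⟨e, -⟩ := exists_basis_mem_range f haff hη
  obtain ⟨c, hc0, hc⟩ := exists_denominator f haff hη e
  obtain ⟨P, hP⟩ := (D.eventually_exists_linearMap_sections_pi f K hs hη haff e hc hc0).exists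
  refine ⟨d * P, fun m hfin => ?_⟩
  obtain ⟨Ψ, hΨ⟩ := hP m
  exact Module.Finite.of_injective Ψ hΨ

variable {K D}

/-- **The `h⁰`-asymptotic degree transfers along finite flat covers** (the content of
Görtz–Wedhorn II, Prop. 23.84 for `h⁰`-asymptotics, unconditionally): for `f : X → Y` finite
flat surjective of constant rank `r` between integral `K`-schemes (`Y` quasi-compact) and `D`
ample on `Y`, `h⁰(nD) = δ nᵉ/e! + O(nᵉ⁻¹)` with `δ > 0` implies
`h⁰(n f^*D) = rδ nᵉ/e! + O(nᵉ⁻¹)`. Proof: `δ > 0` makes `Γ(Y, 𝒪(nD))` finite-dimensional for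
`n ≫ 0`, hence also `Γ(X, 𝒪(n f^*D))` (`exists_finiteDimensional_pullback_of_finiteDimensional`),
so the sandwich `r h⁰(mD) ≤ h⁰((m+a) f^*D)`, `h⁰(m f^*D) ≤ r h⁰((m+a)D)`
(`sandwich_h0_of_isAmple`) holds for `m ≫ 0`, and `isBigO_of_sandwich` concludes.
[cite: GortzWedhorn2023, Prop. 23.84 with Def. 23.76 (pp. 445–447)] -/
theorem HasAsympDegree.pullback_of_isAmple [Flat f] [Surjective f] (hD : D.IsAmple) {r : ℕ}
    (hr : ∀ y : Y, f.finrank y = r) {e δ : ℕ} (h : D.HasAsympDegree K e δ) (hδ : 0 < δ) :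
    (D.pullback f).HasAsympDegree K e (r * δ) := by
  obtain ⟨a, ha⟩ := sandwich_h0_of_isAmple K f r hr D hD
  obtain ⟨a', ha'⟩ := D.exists_finiteDimensional_pullback_of_finiteDimensional K f hD
  have hP := h.eventually_finiteDimensional hδ
  have hQ : ∀ᶠ m : ℕ in atTop, FiniteDimensional K ((m • D.pullback f).sections K) := by
    filter_upwards [(tendsto_add_atTop_nat a').eventually hP] with m hm using ha' m hm
  have h1 : ∀ᶠ m : ℕ in atTop, (r : ℝ) * ((m • D).h0 K : ℝ) ≤ (((m + a) • D.pullback f).h0 K : ℝ) := by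
    filter_upwards [(tendsto_add_atTop_nat a).eventually hQ] with m hm
    exact_mod_cast (ha m).1 hm
  have h2 : ∀ᶠ m : ℕ in atTop, (((m • D.pullback f).h0 K : ℝ)) ≤ (r : ℝ) * (((m + a) • D).h0 K : ℝ) := by
    filter_upwards [(tendsto_add_atTop_nat a).eventually hP] with m hm
    exact_mod_cast (ha m).2 hm
  have key := isBigO_of_sandwich (u := fun n : ℕ => ((n • D).h0 K : ℝ))
    (v := fun n : ℕ => ((n • D.pullback f).h0 K : ℝ)) h (Nat.cast_nonneg r) h1 h2
  unfold HasAsympDegree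
  refine key.congr_left fun n => ?_
  push_cast
  ring

/-- **`asympDegree(f^*D, dim X) = r · asympDegree(D, dim Y)` whenever `D` has a positive
`h⁰`-asymptotic degree** in dimension `dim Y` (`= dim X`,
`Scheme.schemeDim_eq_of_isFinite_of_surjective`) — the conclusion of the named fact
`asympDegree_pullback_eq` (Görtz–Wedhorn II, Prop. 23.84) for the pair `(f, D)`, conditional
only on the existence clause of Prop. 23.83 for `D` (`HasAsympDegree.pullback_of_isAmple`).
[cite: GortzWedhorn2023, Prop. 23.84 with Prop. 23.83 (p. 447)] -/
theorem asympDegree_pullback_eq_of_hasAsympDegree [Flat f] [Surjective f] (hD : D.IsAmple)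
    {r : ℕ} (hr : ∀ y : Y, f.finrank y = r) {δ : ℕ} (h : D.HasAsympDegree K (schemeDim Y) δ)
    (hδ : 0 < δ) :
    (D.pullback f).asympDegree K (schemeDim X) = r * D.asympDegree K (schemeDim Y) := by
  rw [Scheme.schemeDim_eq_of_isFinite_of_surjective f, h.asympDegree_eq,
    (h.pullback_of_isAmple f hD hr hδ).asympDegree_eq]

end CartierDivisor


/-! ### The boundary of the elementary method: all cases of the named fact but one -/

namespace CartierDivisor

open FunctionFieldOver

variable (K : Type u) [Field K] {X Y : Scheme.{u}} [IsIntegral X] [IsIntegral Y]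
  [X.Over (Spec (.of K))] [Y.Over (Spec (.of K))] (f : X ⟶ Y) [IsDominant f]
  [f.IsOver (Spec (.of K))] [IsFinite f] (D : CartierDivisor Y)

/-- If no `h⁰`-asymptotic degree exists, `asympDegree` is the junk value `0`. [folklore] -/
theorem asympDegree_eq_zero_of_not_exists {Z : Scheme.{u}} [IsIntegral Z] [Z.Over (Spec (.of K))]
    (E : CartierDivisor Z) {d : ℕ} (h : ¬ ∃ δ : ℕ, E.HasAsympDegree K d δ) :
    E.asympDegree K d = 0 := by
  unfold asympDegree
  rw [dif_neg h]

/-- **Finite-dimensionality transfers downstairs**: for `D` ample on `Y` (quasi-compact) there is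
`a''` such that `Γ(Y, 𝒪(mD))` is finite-dimensional whenever `Γ(X, 𝒪((m+a'') f^*D))` is — by
the injection `Γ(mD)^r ↪ Γ((m+a'') f^*D)` of `Motives/FiniteFlatSandwich`
(`eventually_exists_linearMap_pi_sections`; `r = [K(X) : K(Y)] ≥ 1`). [folklore] -/
theorem exists_finiteDimensional_of_finiteDimensional_pullback (hD : D.IsAmple) :
    ∃ a'' : ℕ, ∀ m : ℕ, FiniteDimensional K (((m + a'') • D.pullback f).sections K) →
      FiniteDimensional K ((m • D).sections K) := by
  obtain ⟨hc, -, d, -, H⟩ := hD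
  obtain ⟨s, hs, hη, haff⟩ := H (genericPoint Y)
  obtain ⟨e, he⟩ := exists_basis_mem_range f haff hη
  obtain ⟨N, hN⟩ := (D.eventually_exists_linearMap_pi_sections f K hs hη e he).exists
  refine ⟨d * N, fun m hfin => ?_⟩
  obtain ⟨Φ, hΦ⟩ := hN m
  haveI : Module.Finite K (Fin (Module.finrank Y.functionField (FunctionFieldOver f)) →
      (m • D).sections K) := Module.Finite.of_injective Φ hΦ
  haveI : FiniteDimensional Y.functionField (FunctionFieldOver f) := finiteDimensional f haff hη
  obtain ⟨l₀⟩ : Nonempty (Fin (Module.finrank Y.functionField (FunctionFieldOver f))) :=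
    ⟨⟨0, Module.finrank_pos⟩⟩
  exact Module.Finite.of_surjective (LinearMap.proj l₀ :
    (Fin (Module.finrank Y.functionField (FunctionFieldOver f)) → (m • D).sections K) →ₗ[K] _)
    (fun x => ⟨fun _ => x, rfl⟩)

variable {K D}

/-- **Transfer of the zero asymptotic degree**: if `h⁰(nD) = O(nᵉ⁻¹)` (asymptotic degree `0`) and
the spaces `Γ(X, 𝒪(m f^*D))` are finite-dimensional for `m ≫ 0`, then `h⁰(n f^*D) = O(nᵉ⁻¹)`
too — from the upper bound `h⁰(m f^*D) ≤ r h⁰((m+a)D)` alone (`sandwich_h0_of_isAmple`; the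
finite-dimensionality downstairs that it needs comes from upstairs,
`exists_finiteDimensional_of_finiteDimensional_pullback`). [folklore] -/
theorem HasAsympDegree.pullback_zero_of_isAmple [Flat f] [Surjective f] (hD : D.IsAmple) {r : ℕ}
    (hr : ∀ y : Y, f.finrank y = r) {e : ℕ} (h : D.HasAsympDegree K e 0)
    (hQ : ∀ᶠ m : ℕ in atTop, FiniteDimensional K ((m • D.pullback f).sections K)) :
    (D.pullback f).HasAsympDegree K e 0 := by
  obtain ⟨a, ha⟩ := sandwich_h0_of_isAmple K f r hr D hD
  obtain ⟨a'', ha''⟩ := D.exists_finiteDimensional_of_finiteDimensional_pullback K f hD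
  have hP : ∀ᶠ m : ℕ in atTop, FiniteDimensional K ((m • D).sections K) := by
    filter_upwards [(tendsto_add_atTop_nat a'').eventually hQ] with m hm using ha'' m hm
  have h2 : ∀ᶠ m : ℕ in atTop, (((m • D.pullback f).h0 K : ℝ)) ≤ (r : ℝ) * (((m + a) • D).h0 K : ℝ) := by
    filter_upwards [(tendsto_add_atTop_nat a).eventually hP] with m hm
    exact_mod_cast (ha m).2 hm
  -- `h⁰((m+a)D) = O(mᵉ⁻¹)`, hence `h⁰(m f^*D) = O(mᵉ⁻¹)`
  have hu : (fun n : ℕ => ((n • D).h0 K : ℝ)) =O[atTop] fun n : ℕ => (n : ℝ) ^ ((e : ℤ) - 1) := by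
    refine h.congr_left fun n => ?_
    push_cast; ring
  have hu' := IsBigO.shift hu a
  have hv : (fun n : ℕ => ((n • D.pullback f).h0 K : ℝ)) =O[atTop]
      fun n : ℕ => (n : ℝ) ^ ((e : ℤ) - 1) := by
    refine (IsBigO.of_bound 1 ?_).trans (hu'.const_mul_left (r : ℝ))
    filter_upwards [h2] with m hm
    rw [one_mul, Real.norm_eq_abs, Real.norm_eq_abs, abs_of_nonneg (Nat.cast_nonneg _),
      abs_of_nonneg (mul_nonneg (Nat.cast_nonneg _) (Nat.cast_nonneg _))]
    exact hm
  unfold HasAsympDegree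
  refine hv.congr_left fun n => ?_
  push_cast; ring

/-- **The named fact `asympDegree_pullback_eq` for `(f, D)` whenever `D` has *some*
`h⁰`-asymptotic degree** in dimension `dim Y` (positive: `asympDegree_pullback_eq_of_hasAsympDegree`;
zero: if `f^*D` had a positive asymptotic degree its sections would be finite-dimensional for
large multiples and `HasAsympDegree.pullback_zero_of_isAmple` would force the degree `0`).
[cite: GortzWedhorn2023, Prop. 23.84 with Prop. 23.83 (p. 447)] -/
theorem asympDegree_pullback_eq_of_exists_hasAsympDegree [Flat f] [Surjective f]
    (hD : D.IsAmple) {r : ℕ} (hr : ∀ y : Y, f.finrank y = r)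
    (hex : ∃ δ : ℕ, D.HasAsympDegree K (schemeDim Y) δ) :
    (D.pullback f).asympDegree K (schemeDim X) = r * D.asympDegree K (schemeDim Y) := by
  obtain ⟨δ, hδ⟩ := hex
  by_cases hpos : 0 < δ
  · exact asympDegree_pullback_eq_of_hasAsympDegree f hD hr hδ hpos
  obtain rfl : δ = 0 := Nat.eq_zero_of_not_pos hpos
  rw [hδ.asympDegree_eq, mul_zero, Scheme.schemeDim_eq_of_isFinite_of_surjective f]
  by_cases hex' : ∃ δ' : ℕ, (D.pullback f).HasAsympDegree K (schemeDim Y) δ'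
  · obtain ⟨δ', hδ'⟩ := hex'
    rw [hδ'.asympDegree_eq]
    by_contra hne
    have hpos' : 0 < δ' := Nat.pos_of_ne_zero hne
    have hQ := hδ'.eventually_finiteDimensional hpos'
    have h0 := hδ.pullback_zero_of_isAmple f hD hr hQ
    exact hne (hδ'.unique h0)
  · exact asympDegree_eq_zero_of_not_exists K _ hex'

/-- **The named fact `asympDegree_pullback_eq` for `(f, D)` whenever `f^*D` has *no positive*
`h⁰`-asymptotic degree** (in dimension `dim X`): both sides vanish — a positive asymptotic degree
`δ` downstairs would give the positive one `rδ` upstairs (`HasAsympDegree.pullback_of_isAmple`).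
Together with `asympDegree_pullback_eq_of_exists_hasAsympDegree` this leaves exactly one
configuration of the junk values not covered by the elementary method: `D` without any
`ℕ`-valued asymptotic degree while `f^*D` has a positive one `δ'` (then necessarily `r ∤ δ'`),
which is excluded only by Görtz–Wedhorn II, Prop. 23.83 for `D` (integrality of the leading
coefficient `(𝒪(D)ᵉ)/e!`). [cite: GortzWedhorn2023, Prop. 23.84 with Prop. 23.83 (p. 447)] -/
theorem asympDegree_pullback_eq_of_forall_not_hasAsympDegree [Flat f] [Surjective f]
    (hD : D.IsAmple) {r : ℕ} (hr : ∀ y : Y, f.finrank y = r)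
    (hno : ∀ δ' : ℕ, 0 < δ' → ¬ (D.pullback f).HasAsympDegree K (schemeDim X) δ') :
    (D.pullback f).asympDegree K (schemeDim X) = r * D.asympDegree K (schemeDim Y) := by
  -- the left-hand side is `0`
  have hL : (D.pullback f).asympDegree K (schemeDim X) = 0 := by
    by_cases hex' : ∃ δ' : ℕ, (D.pullback f).HasAsympDegree K (schemeDim X) δ'
    · obtain ⟨δ', hδ'⟩ := hex'
      rw [hδ'.asympDegree_eq]
      by_contra hne
      exact hno δ' (Nat.pos_of_ne_zero hne) hδ'
    · exact asympDegree_eq_zero_of_not_exists K _ hex'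
  -- and so is the right-hand side
  have hR : D.asympDegree K (schemeDim Y) = 0 := by
    by_cases hex : ∃ δ : ℕ, D.HasAsympDegree K (schemeDim Y) δ
    · obtain ⟨δ, hδ⟩ := hex
      rw [hδ.asympDegree_eq]
      by_contra hne
      have hpos : 0 < δ := Nat.pos_of_ne_zero hne
      have h' := hδ.pullback_of_isAmple f hD hr hpos
      rw [← Scheme.schemeDim_eq_of_isFinite_of_surjective f] at h'
      have hr0 : 0 < r := by
        obtain ⟨x⟩ := (inferInstance : Nonempty X)
        have h1 := f.one_le_finrank_map x
        rw [hr] at h1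
        exact h1
      exact hno (r * δ) (Nat.mul_pos hr0 hpos) h'
    · exact asympDegree_eq_zero_of_not_exists K _ hex
  rw [hL, hR, mul_zero]

end CartierDivisor

end Literature.AlgebraicGeometry.Motives

end
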